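import Mathlib
import HarnessLib
import Summits.HubbardSuperconductivity.HubbardSuperconductivity.Theses.WeakCouplingBCS
import Summits.HubbardSuperconductivity.HubbardSuperconductivity.Theorems.WeakCouplingBCSWcbcsKohnLuttingerB1gFormAWindowD005D035

/-!
# Route `WeakCouplingBCS` — rung R2d: the LOADED PAIR on the leaf's FULL doping window `δ ∈ [0.10, 0.35]`
# (leaf `H1TwoPointLimitKLScaleD` ∩ the certificate half with the stretch records `klCertB1gWinU1`, `klCertB1gWinU2`,
`klCertB1gWinU3`, `klCertB1gWinV`, `klCertB1gWinW`)

Cell `gate-hubbard-kl`, seats `hubbard-kl-cert-2` gen 4 (row «window extension enclosures») and `hubbard-kl-cert-3` gen 4/5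
(second kit identity; assembly of U1/U3 and this glue); director-hubbard WORD 2026-08-27T07:03:18Z:
«the deliverable is the sentence "the loaded pair reads the leaf's full window δ ∈ [0.10, 0.35]"»; LADDER-Hubbard §0 (D): «the rung
converts on the LOADED PAIR»; risk-register item r2 = the window).  Successor of
`…Theorems.WeakCouplingBCSH1TwoPointLimitKLScaleDDopingWindowD010D030` (gen 3: the pair on `[0.10, 0.30]`, six records).

The certificate half now covers the leaf's whole analysis window: the stretch records (102 μ-uniform boxes on
`μ ∈ [-0.8925, -0.7275]`, `δ ≈ 0.30–0.35`) together with `klCertB1gWin{X,Y,Z,A,B,C}` give in form (A)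
(`klb1g_formA_r2d_certificate_d010_d035`, with the UNCONDITIONAL `μ(δ) ∈ [-0.8925, -0.1775]` for `δ ∈ [0.10, 0.35]`,
`muOfDoping_mem_window_d010_d035`, read off `muWinD035_filling_lt : n(-0.8925) < 13/20` and `klfillL010_filling_ge`): for every
`δ ∈ [0.10, 0.35]`, `B1g` leads every other `D₄` channel of the second-order Kohn–Luttinger vertex at `μ(δ)` by `γ U²`,
`γ = 10371 / 1048576` (the smallest of the eleven record margins), for all `U ∈ (0,1)`, AND the `B1g` bottom is certified attractive,
`channelInf ε₀ μ(δ) U B1g ≤ -(1 / 26)·U²`.  The theorem half `H1TwoPointLimitKLScaleD` lives on the SAME window `δ ∈ [0.10, 0.35]`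
— no sub-window restriction is left.  Hence the loaded pair on `[0.10, 0.35]` (`klPair_doping_d010_d035`; packaged with one
`(U₀, c, γ)` as `klPair_doping_d010_d035'`; `klPair_doping_d010_d030_of_d035` restricts it to gen 3's window shape).  Folklore glue,
items consumed BY NAME, modulo the eleven named enclosure hypotheses (cert form (A)); no definitions.  Sources: S. Raghu,
S. A. Kivelson, D. J. Scalapino, Phys. Rev. B 81 (2010) 224505, §III Fig. 2; G. Benfatto, A. Giuliani, V. Mastropietro,
Ann. Henri Poincaré 7 (2006) 809, Thm 1.1.  Numerics of the records: cell HOME/hubbard-kl-cert-2/MU-WINDOW-4.md (tables: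
HOME/hubbard-kl-cert-3/STRETCH-TABLE-g5.md)
(250 μ-uniform boxes on `[-0.8925, -0.075]`, two implementations; kit jobs j272077 j272078 j272079 j272081 (cert-2 g4) j275695
j275696 j275697 j275698 j275701 j281058 j281059 j281060 (cert-3 g4)).
-/

noncomputable section

-- the tree's namespace `Summit.<Summit>.<Problem>.Theorems` repeats the summit name by design (D-0017)
set_option linter.dupNamespace false

namespace Summit.HubbardSuperconductivity.HubbardSuperconductivity.Theorems.R2dH1

open Filter Set
open Literature.MathematicalPhysics.QuantumLattice Literature.Probability.LatticeModels
open Summit.HubbardSuperconductivity.HubbardSuperconductivity.Theses.WeakCouplingBCS (H1TwoPointLimitKLScaleD)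
open scoped Topology

/-- **THE LOADED PAIR of rung R2d on the leaf's FULL window `δ ∈ [0.10, 0.35]`, explicit certificate constants.**  From the eleven
window enclosure records (the 5 stretch records + `klCertB1gWin{X,Y,Z}` + `klCertB1gWin{A,B,C}`, cert form (A)) and the leaf
`H1TwoPointLimitKLScaleD`: there are `U₀, c > 0` such that for every `δ ∈ [0.10, 0.35]`, at the free-band chemical potential `μ(δ)`:
(selection) `channelInf ε₀ μ(δ) U B1g + (10371 / 1048576)·U² ≤ channelInf ε₀ μ(δ) U χ` for all `U ∈ (0,1)` and every `χ ≠ B1g`;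
(attraction) `channelInf ε₀ μ(δ) U B1g ≤ -(1 / 26)·U²` for every `U`; (control) the thermal two-point functions of the Hubbard
torus at `μ(δ)` converge as `L → ∞` for all `0 < U ≤ U₀`, `0 < β ≤ e^{c/U²}`. [cite: RaghuKivelsonScalapino2010, §III Fig. 2] -/
theorem klPair_doping_d010_d035 (hU1 : klCertB1gWinU1.EnclosuresB1g) (hU2 : klCertB1gWinU2.EnclosuresB1g)
    (hU3 : klCertB1gWinU3.EnclosuresB1g) (hV : klCertB1gWinV.EnclosuresB1g) (hW : klCertB1gWinW.EnclosuresB1g)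
    (hX : klCertB1gWinX.EnclosuresB1g) (hY : klCertB1gWinY.EnclosuresB1g)
    (hZ : klCertB1gWinZ.EnclosuresB1g) (hA : klCertB1gWinA.EnclosuresB1g) (hB : klCertB1gWinB.EnclosuresB1g)
    (hC : klCertB1gWinC.EnclosuresB1g) (h : H1TwoPointLimitKLScaleD) :
    ∃ U₀ c : ℝ, 0 < U₀ ∧ 0 < c ∧ ∀ δ ∈ Set.Icc (0.10 : ℝ) 0.35,
      (∀ U ∈ Set.Ioo (0 : ℝ) 1, ∀ χ : D4Irrep, χ ≠ D4Irrep.B1g →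
        channelInf (squareDispersion 1 0) (chemicalPotentialOfDensity (squareDispersion 1 0) (1 - δ)) U D4Irrep.B1g +
            (10371 / 1048576 : ℝ) * U ^ 2 ≤
          channelInf (squareDispersion 1 0) (chemicalPotentialOfDensity (squareDispersion 1 0) (1 - δ)) U χ) ∧
      (∀ U : ℝ, channelInf (squareDispersion 1 0) (chemicalPotentialOfDensity (squareDispersion 1 0) (1 - δ)) U
          D4Irrep.B1g ≤ -(1 / 26 : ℝ) * U ^ 2) ∧
      (∀ U β : ℝ, 0 < U → U ≤ U₀ → 0 < β → β ≤ Real.exp (c / U ^ 2) →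
        ∀ (x y : Site 2) (σ σ' : Fin 2), ∃ S : ℂ,
          Tendsto (fun L : ℕ => hubbardThermalTwoPoint β U
            (chemicalPotentialOfDensity (squareDispersion 1 0) (1 - δ)) L x y σ σ') atTop (𝓝 S)) := by
  obtain ⟨U₀, c, hU₀, hc, H⟩ := h
  have hcert := klb1g_formA_r2d_certificate_d010_d035 hU1 hU2 hU3 hV hW hX hY hZ hA hB hC
  exact ⟨U₀, c, hU₀, hc, fun δ hδ => ⟨(hcert δ hδ).1, (hcert δ hδ).2, H δ hδ⟩⟩

/-- **The loaded pair on `[0.10, 0.35]`, packaged with ONE set of constants `(U₀, c, γ)`** (the shape of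
`R2dH1.klPair_doping_d010_d020` on the window of record; here `γ = 10371 / 1048576` and `U₀ ≤ 1`). [cite:
RaghuKivelsonScalapino2010, §III Fig. 2] -/
theorem klPair_doping_d010_d035' (hU1 : klCertB1gWinU1.EnclosuresB1g) (hU2 : klCertB1gWinU2.EnclosuresB1g)
    (hU3 : klCertB1gWinU3.EnclosuresB1g) (hV : klCertB1gWinV.EnclosuresB1g) (hW : klCertB1gWinW.EnclosuresB1g)
    (hX : klCertB1gWinX.EnclosuresB1g) (hY : klCertB1gWinY.EnclosuresB1g)
    (hZ : klCertB1gWinZ.EnclosuresB1g) (hA : klCertB1gWinA.EnclosuresB1g) (hB : klCertB1gWinB.EnclosuresB1g)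
    (hC : klCertB1gWinC.EnclosuresB1g) (h : H1TwoPointLimitKLScaleD) :
    ∃ U₀ c γ : ℝ, 0 < U₀ ∧ 0 < c ∧ 0 < γ ∧ ∀ δ ∈ Set.Icc (0.10 : ℝ) 0.35,
      (∀ U ∈ Set.Ioo (0 : ℝ) U₀, ∀ χ : D4Irrep, χ ≠ D4Irrep.B1g →
        channelInf (squareDispersion 1 0) (chemicalPotentialOfDensity (squareDispersion 1 0) (1 - δ)) U D4Irrep.B1g +
            γ * U ^ 2 ≤
          channelInf (squareDispersion 1 0) (chemicalPotentialOfDensity (squareDispersion 1 0) (1 - δ)) U χ) ∧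
      (∀ U β : ℝ, 0 < U → U ≤ U₀ → 0 < β → β ≤ Real.exp (c / U ^ 2) →
        ∀ (x y : Site 2) (σ σ' : Fin 2), ∃ S : ℂ,
          Tendsto (fun L : ℕ => hubbardThermalTwoPoint β U
            (chemicalPotentialOfDensity (squareDispersion 1 0) (1 - δ)) L x y σ σ') atTop (𝓝 S)) := by
  obtain ⟨U₀, c, hU₀, hc, H⟩ := klPair_doping_d010_d035 hU1 hU2 hU3 hV hW hX hY hZ hA hB hC h
  refine ⟨min U₀ 1, c, 10371 / 1048576, lt_min hU₀ one_pos, hc, by norm_num, fun δ hδ => ⟨?_, ?_⟩⟩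
  · intro U hU χ hχ
    exact (H δ hδ).1 U ⟨hU.1, lt_of_lt_of_le hU.2 (min_le_right _ _)⟩ χ hχ
  · intro U β hU hUle
    exact (H δ hδ).2.2 U β hU (hUle.trans (min_le_left _ _))

/-- **Monotonicity in the window: the pair on `[0.10, 0.35]` restricts to gen 3's window `[0.10, 0.30]`** with the stretch constants
(a consumer that reads `[0.10, 0.30]` may take the eleven-record hypotheses at the price `14349/1048576 → 10371 / 1048576`, `1/16
→ 1 / 26`).
[folklore] -/
theorem klPair_doping_d010_d030_of_d035 (hU1 : klCertB1gWinU1.EnclosuresB1g) (hU2 : klCertB1gWinU2.EnclosuresB1g)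
    (hU3 : klCertB1gWinU3.EnclosuresB1g) (hV : klCertB1gWinV.EnclosuresB1g) (hW : klCertB1gWinW.EnclosuresB1g)
    (hX : klCertB1gWinX.EnclosuresB1g) (hY : klCertB1gWinY.EnclosuresB1g)
    (hZ : klCertB1gWinZ.EnclosuresB1g) (hA : klCertB1gWinA.EnclosuresB1g) (hB : klCertB1gWinB.EnclosuresB1g)
    (hC : klCertB1gWinC.EnclosuresB1g) (h : H1TwoPointLimitKLScaleD) :
    ∃ U₀ c : ℝ, 0 < U₀ ∧ 0 < c ∧ ∀ δ ∈ Set.Icc (0.10 : ℝ) 0.30,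
      (∀ U ∈ Set.Ioo (0 : ℝ) 1, ∀ χ : D4Irrep, χ ≠ D4Irrep.B1g →
        channelInf (squareDispersion 1 0) (chemicalPotentialOfDensity (squareDispersion 1 0) (1 - δ)) U D4Irrep.B1g +
            (10371 / 1048576 : ℝ) * U ^ 2 ≤
          channelInf (squareDispersion 1 0) (chemicalPotentialOfDensity (squareDispersion 1 0) (1 - δ)) U χ) ∧
      (∀ U : ℝ, channelInf (squareDispersion 1 0) (chemicalPotentialOfDensity (squareDispersion 1 0) (1 - δ)) U
          D4Irrep.B1g ≤ -(1 / 26 : ℝ) * U ^ 2) ∧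
      (∀ U β : ℝ, 0 < U → U ≤ U₀ → 0 < β → β ≤ Real.exp (c / U ^ 2) →
        ∀ (x y : Site 2) (σ σ' : Fin 2), ∃ S : ℂ,
          Tendsto (fun L : ℕ => hubbardThermalTwoPoint β U
            (chemicalPotentialOfDensity (squareDispersion 1 0) (1 - δ)) L x y σ σ') atTop (𝓝 S)) := by
  obtain ⟨U₀, c, hU₀, hc, H⟩ := klPair_doping_d010_d035 hU1 hU2 hU3 hV hW hX hY hZ hA hB hC h
  exact ⟨U₀, c, hU₀, hc, fun δ hδ => H δ ⟨hδ.1, hδ.2.trans (by norm_num)⟩⟩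

end Summit.HubbardSuperconductivity.HubbardSuperconductivity.Theorems.R2dH1

end
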